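/-
Copyright (c) 2026 the pub-hodgecm-mathlib formalisation cell (harness21).  Prover seat hodgecm-mathlib-LH4-p02 (g12): STAGE 1a «(D-RAM) FOUR-FRAME» road,
tier-1 module `U4_Rows` §2 (iv-a)·T3 (dealer LH4-plan (g10) WORD #24∕#26): the CLASS-`−` TRANSVECTION diagonal witness of `stub_U4_table_diag_ne_zero`; 2026-09-03.
-/
import Summits.HodgeConjecture.HodgeConjecture.Theorems.F0P3cDyRamUnipotentLabelInjOn        -- ★ p854790 (this seat): `isConj_of_not_normClassPlus`, `normClassPlus_conj_corner_iff`, `B₀_xPlus_mulVec`; brings T1 inputs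
import Summits.HodgeConjecture.HodgeConjecture.Theorems.F0P3cDyRamDOfPlaceOfDatum            -- ★ p854662 (this seat): `dOfPlace_eq_of_isRamifiedQuadraticDatum`
import Literature.NumberTheory.LocalFields.WildQuadraticDatumNormSurjective                     -- ★ p854729 (this seat): `exists_mul_map_eq_of_isRamifiedQuadraticDatum` (fixed units `≡ 1 (ϖ^{2d})` are norms)
import Literature.NumberTheory.LocalFields.ValuedCompleteIsAdicComplete                         -- ★ p854812 (this seat): BRIDGE-AC `isAdicComplete_valuedInteger_of_completeSpace`
import Literature.NumberTheory.Automorphic.UnitaryLevelTwoInteriorRelabel                       -- ★ `mem_cmLocalIntegralLevel_iff_isIntMatrix`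
import HarnessLib

/-!
# Crux `H413`, line LH4 «(D-RAM) FOUR-FRAME», module `U4_Rows` §2 (iv-a)·T3: the CLASS-`−` DIAGONAL WITNESS — a depth-`ℓ₀` shell transvection `n(η·t₊) ∈ K` of
# norm class `−` whose LABEL at level `m*` is `−` (the precision `m* − ℓ₀ = 2d − 1` is the conductor)

Cell `hodgecm-mathlib` (D-0151), FLOOR 0, crux item H413 = `stmt-HodgeConjecture-24833`, route of record `HCCMUnconditional`; squad F0∕P3c∕LH4 Track A; dealer
LH4-plan (g10) WORD #24∕#26 (T3 → this seat; T₊ twin → LH4-p13 (g0)).  THEOREMS ONLY (no `def`, no instance, no notation, no `sorry`, default heartbeats); lane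
`--supports stmt-HodgeConjecture-24833 --as helper`.

WHAT IS PROVED.  `exists_mem_supportTransvMinus_mk_eq`: at a ramified `σ`-stable place with uniformizer `ϖ`, every conjugacy class `c` of `G = U(Φ₃)(L⁺_v)` whose
representative `u` is a transvection (`X ≠ 0 = X²`, `X = wMatrix u − 1`) WITHOUT `NormClassPlus` meets the support set of the piece `f_{T−}` of ★ №3: there is
`x ∈ K` on the shell `NearTransvShell ϖ ℓ₀ m*` with `¬ LabelPlus σ_w ϖ d m* (wMatrix x − 1)` and `ConjClasses.mk x = c`.  THE WITNESS (REF5 R5-11 (T3)): `n(η·t₊)`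
with `t₊ = (ϖ − σϖ)∕N(ϖ)^{⌊d∕2⌋}` (the coefficient of ★ `xPlus`, `|t₊| = |ϖ|^{ℓ₀}`) and `η` a `σ_w`-FIXED NON-NORM UNIT (§2: the non-norm `ε` of ★ `IsCMField.
exists_fixed_nonnorm_dichotomy'` has even valuation `2n`; rescale by the norm `N(ϖ)^n`).  THE M-STEP (§1 `not_labelPlus_corner_of_nonnorm_unit`): if the value sets
mod `ϖ^{m*}` of `η t₊·E₁₃` and `t₊·E₁₃` agreed, then `t₊ ≡ η t₊ N(y)` (mod `ϖ^{m*}`) for an integral `y`, i.e. `|1 − η N(y)| ≤ |ϖ|^{m* − ℓ₀} = |ϖ|^{2d−1}`; a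
non-zero `σ`-fixed element has EVEN valuation, so `|1 − η N(y)| ≤ |ϖ|^{2d}`, and ★ p854729 (fixed units `≡ 1 (mod ϖ^{2d})` are norms; `IsAdicComplete` at `L_w` by
BRIDGE-AC ★ p854812) makes `η N(y)`, hence `η`, a norm — contradiction.  Conjugacy `x ~ out c`: both corner coefficients lie off `t₊·N` (★ T1 `isConj_of_not_normClassPlus`,
norm index two).

HONEST LABEL.  Count-neutral helper (`--supports 24833`) feeding the T3 payer.  (D-RAM) verdict of record PRINT [LanglandsShelstad1989 Thm. p. 484 ∕ Rogawski1990
Prop. 4.9.1 (a)] ∕ XL; `HC_CM` is proved only modulo the 7 printed citations (2 remaining: hLiu418 = `stmt-HodgeConjecture-24832`, h413 = `stmt-HodgeConjecture-24833`)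
until rung 0 closes.

## References
* [Rogawski1990] J. D. Rogawski, *Automorphic Representations of Unitary Groups in Three Variables*, Ann. of Math. Stud. 123 (1990), §3.9 p. 32 (singular classes
  `[n(t)]`, `t ∈ E⁰∕N E^×`), §4.9 Prop. 4.9.1 (b) p. 55.
* [Serre1979] J.-P. Serre, *Local Fields*, GTM 67 (1979), Ch. V §3 (norm groups and the conductor of a ramified quadratic extension), Ch. XIV §3.
-/

noncomputable section

namespace Summit.HodgeConjecture.HodgeConjecture.Cruxes.H413.F0P3cDyRamTableDiagWitnessTransvMinus

open NumberField IsDedekindDomain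
open Literature.NumberTheory.Automorphic Literature.NumberTheory.Automorphic.UnitaryGroup
open Literature.NumberTheory.Automorphic.HermitianLattice Literature.NumberTheory.Automorphic.UnitaryThreeFourFrame
open Literature.NumberTheory.Automorphic.UnitaryLatticeTree
open Literature.NumberTheory.Rogawski1990 Literature.NumberTheory.GaloisRepresentations
open Summit.HodgeConjecture.HodgeConjecture.Cruxes.H413.F0P3cDyRamFourFramePieces
open Summit.HodgeConjecture.HodgeConjecture.Cruxes.H413.F0P3cDyRamWildPlaceDatum
open Summit.HodgeConjecture.HodgeConjecture.Cruxes.H413.F0P3cDyRamDOfPlaceOfDatum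
open Summit.HodgeConjecture.HodgeConjecture.Cruxes.H413.F0P3cDyRamUnipotentLabelInjOn
open Summit.HodgeConjecture.HodgeConjecture.Cruxes.H413.F0P3cDyRamFourFrameUnipotentLabelDefs
open scoped Matrix MatrixGroups Valued WithZero
open WithZero

/-! ## §1 Field level: the nilpotent `c·E₁₃`, its level∕shell bookkeeping, its value set, and the M-step -/

section Field

variable {K : Type*} [Field K] [Valued K ℤᵐ⁰] (σ : K →+* K)

omit [Valued K ℤᵐ⁰] in
/-- `n(c) − 1 = c·E₁₃`. [cite: Rogawski1990, §1.10 p. 9] -/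
theorem cornerUnipotent_sub_one (c : K) : (!![1, 0, c; 0, 1, 0; 0, 0, 1] : Matrix (Fin 3) (Fin 3) K) - 1 = !![0, 0, c; 0, 0, 0; 0, 0, 0] := by
  ext i j; fin_cases i <;> fin_cases j <;> simp

omit [Valued K ℤᵐ⁰] in
/-- `(c·E₁₃)² = 0`. [cite: Rogawski1990, §3.9 p. 32] -/
theorem cornerNilp_mul_self (c : K) : (!![0, 0, c; 0, 0, 0; 0, 0, 0] : Matrix (Fin 3) (Fin 3) K) * !![0, 0, c; 0, 0, 0; 0, 0, 0] = 0 := by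
  ext i j; fin_cases i <;> fin_cases j <;> simp [Matrix.mul_apply, Fin.sum_univ_three]

omit [Valued K ℤᵐ⁰] in
/-- ★ `xPlus σ ϖ d = t₊·E₁₃`, `t₊ = (ϖ − σϖ)·((ϖσϖ)^{⌊d∕2⌋})⁻¹`. [cite: Rogawski1990, §3.9 p. 32] -/
theorem xPlus_eq (ϖ : K) (d : ℕ) : xPlus σ ϖ d = !![0, 0, (ϖ - σ ϖ) * ((ϖ * σ ϖ) ^ ((d - d % 2) / 2))⁻¹; 0, 0, 0; 0, 0, 0] := by
  ext i j; fin_cases i <;> fin_cases j <;> simp [xPlus]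

omit [Valued K ℤᵐ⁰] in
/-- The pairing value of `c·E₁₃`: `B₀(y, (c·E₁₃)y) = c·σ(y₂)·y₂`. [cite: Rogawski1990, §3.9 p. 32] -/
theorem pairing_cornerNilp_mulVec (c : K) (y : Fin 3 → K) :
    UnitaryLatticeTree.pairing σ ((StdForm.antidiagonal 3).over K) y ((!![0, 0, c; 0, 0, 0; 0, 0, 0] : Matrix (Fin 3) (Fin 3) K).mulVec y) = c * (σ (y 2) * y 2) := by
  rw [UnitaryLatticeTree.pairing_antidiagonal, B₀_three_apply]
  simp [Matrix.mulVec, dotProduct, Fin.sum_univ_three]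
  ring

/-- `InLevel ϖ n (c·E₁₃) ↔ |(ϖⁿ)⁻¹·c| ≤ 1`. [cite: Kottwitz1986BaseChangeUnits, §1 pp. 240–241] -/
theorem inLevel_cornerNilp_iff (ϖ : K) (n : ℕ) (c : K) :
    InLevel ϖ n (!![0, 0, c; 0, 0, 0; 0, 0, 0] : Matrix (Fin 3) (Fin 3) K) ↔ Valued.v ((ϖ ^ n)⁻¹ * c) ≤ 1 := by
  constructor
  · intro h; exact h 0 2
  · intro h i j
    fin_cases i <;> fin_cases j <;> first | exact h | simp

/-- **THE M-STEP** (REF5 R5-11 (T3): the label precision `m* − ℓ₀ = 2d − 1` is the conductor): for a ramified quadratic datum `(σ, ϖ, d, t)`, `t₊` the coefficient of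
★ `xPlus` and `η` a `σ`-FIXED NON-NORM (a unit in the application), the value sets mod `ϖ^{m*}` (`m* = ℓ₀ + 2d − 1`) of `η t₊·E₁₃` and of `t₊·E₁₃` DIFFER: `¬ LabelPlus σ ϖ d m* (η t₊·E₁₃)`.
Indeed equality would give `t₊ ≡ η t₊·N(y)` (mod `ϖ^{m*}`), so `|1 − η N(y)| ≤ |ϖ|^{2d−1}`, hence `≤ |ϖ|^{2d}` (even valuation of fixed elements), and the fixed unit
`η N(y) ≡ 1 (mod ϖ^{2d})` is a norm (★ p854729) — so `η` is a norm. [cite: Serre1979, Ch. V §3] [cite: Rogawski1990, §3.9 p. 32] -/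
theorem not_labelPlus_corner_of_nonnorm_unit {K : Type} [Field K] [Valued K ℤᵐ⁰] [IsAdicComplete 𝓂[K] 𝒪[K]] (σ : K →+* K) (ϖ : K) (d t : ℕ)
    (hD : IsRamifiedQuadraticDatum σ ϖ d t) {η : K} (hση : σ η = η) (hηN : ¬ ∃ r : K, r * σ r = η) :
    ¬ LabelPlus σ ϖ d (mstarOfRecord d)
      (!![0, 0, η * ((ϖ - σ ϖ) * ((ϖ * σ ϖ) ^ ((d - d % 2) / 2))⁻¹); 0, 0, 0; 0, 0, 0] : Matrix (Fin 3) (Fin 3) K) := by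
  have ⟨hσ, hvσ, hϖ, heven, hd, h1d, _⟩ := hD
  obtain ⟨tp, htp⟩ : ∃ tp : K, (ϖ - σ ϖ) * ((ϖ * σ ϖ) ^ ((d - d % 2) / 2))⁻¹ = tp := ⟨_, rfl⟩
  have hk : 2 * ((d - d % 2) / 2) + d % 2 = d := by omega
  have hϖ0 : ϖ ≠ 0 := fun h => by rw [h, map_zero] at hϖ; exact WithZero.coe_ne_zero hϖ.symm
  have hσϖ0 : σ ϖ ≠ 0 := (map_ne_zero σ).2 hϖ0
  have hvtp : Valued.v tp = exp (-((d % 2 : ℕ) : ℤ)) := by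
    rw [← htp, map_mul, map_inv₀, map_pow, map_mul, hvσ, hd, hϖ, ← pow_two, ← pow_mul, ← exp_nsmul, ← exp_nsmul, smul_neg, smul_neg, nsmul_eq_mul,
      nsmul_eq_mul, mul_one, mul_one, ← exp_neg, neg_neg, ← exp_add]
    congr 1; push_cast; omega
  have htp0 : tp ≠ 0 := fun h => by rw [h, map_zero] at hvtp; exact WithZero.coe_ne_zero hvtp.symm
  intro hL
  rw [LabelPlus, xPlus_eq, htp] at hL
  -- `t₊ ∈ valueSetMod m* (t₊·E₁₃)` (witness `y = e₂`), hence `∈ valueSetMod m* (η t₊·E₁₃)`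
  have hmem : tp ∈ valueSetMod σ ϖ (mstarOfRecord d) (!![0, 0, tp; 0, 0, 0; 0, 0, 0] : Matrix (Fin 3) (Fin 3) K) := by
    refine ⟨Pi.single 2 1, fun a => ?_, ?_⟩
    · by_cases ha : a = 2
      · subst ha; simp
      · rw [Pi.single_eq_of_ne ha, map_zero]; exact zero_le
    · rw [pairing_cornerNilp_mulVec, Pi.single_eq_same, map_one, mul_one, mul_one, sub_self, mul_zero, map_zero]; exact zero_le
  rw [← hL] at hmem
  obtain ⟨y, hy, hval⟩ := hmem
  rw [pairing_cornerNilp_mulVec] at hval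
  -- `|1 − η N(y₂)| ≤ |ϖ|^{m* − ℓ₀} = |ϖ|^{2d − 1}`
  obtain ⟨s, hs⟩ : ∃ s : K, η * (σ (y 2) * y 2) = s := ⟨_, rfl⟩
  have hσs : σ s = s := by rw [← hs, map_mul, map_mul, hση, hσ, mul_comm (y 2) (σ (y 2))]
  have hfac : tp - η * tp * (σ (y 2) * y 2) = tp * (1 - s) := by rw [← hs]; ring
  rw [hfac, map_mul, map_mul, map_inv₀, map_pow, hϖ, hvtp, ← exp_nsmul, smul_neg, nsmul_eq_mul, mul_one, ← exp_neg, neg_neg] at hval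
  -- `hval : exp m* * (exp (−ℓ₀) * |1 − s|) ≤ 1`
  have hs1 : (1 : K) - s ≠ 0 := by
    intro h10
    have hs1 : s = 1 := (sub_eq_zero.1 h10).symm
    have hy0 : y 2 ≠ 0 := by rintro hy0; rw [hy0, mul_zero, mul_zero] at hs; exact one_ne_zero (hs1 ▸ hs).symm
    have hσy0 : σ (y 2) ≠ 0 := (map_ne_zero σ).2 hy0
    refine hηN ⟨(y 2)⁻¹, ?_⟩
    have : η * (σ (y 2) * y 2) = 1 := hs.trans hs1
    rw [map_inv₀, eq_comm]
    calc η = η * (σ (y 2) * y 2) * ((y 2)⁻¹ * (σ (y 2))⁻¹) := by field_simp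
      _ = (y 2)⁻¹ * (σ (y 2))⁻¹ := by rw [this, one_mul]
  obtain ⟨j, hj⟩ := heven (1 - s) (by rw [map_sub, map_one, hσs]) hs1
  rw [hj, ← mul_assoc, ← exp_add, ← exp_add, ← exp_zero, exp_le_exp] at hval
  have hmst : ((mstarOfRecord d : ℕ) : ℤ) = (d % 2 : ℕ) + 2 * d - 1 := by
    simp only [mstarOfRecord]; omega
  rw [hmst] at hval
  -- even valuation ⇒ `|s − 1| ≤ |ϖ|^{2d}`
  have hle : Valued.v (s - 1) ≤ Valued.v ϖ ^ (2 * d) := by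
    rw [Valuation.map_sub_swap, hj, hϖ, ← exp_nsmul, smul_neg, nsmul_eq_mul, mul_one, exp_le_exp]; push_cast; omega
  -- so `s = η N(y₂)` is a norm (★ p854729), and `η` is a norm
  obtain ⟨z, hz, -⟩ := Literature.NumberTheory.LocalFields.WildQuadraticDatum.exists_mul_map_eq_of_isRamifiedQuadraticDatum σ ϖ d t hD s hσs hle
  have hy0 : y 2 ≠ 0 := by
    rintro hy0
    rw [hy0, mul_zero, mul_zero] at hs
    rw [← hs, sub_zero, map_one, ← exp_zero, exp_inj] at hj
    omega
  have hσy0 : σ (y 2) ≠ 0 := (map_ne_zero σ).2 hy0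
  refine hηN ⟨z * (y 2)⁻¹, ?_⟩
  rw [map_mul, map_inv₀]
  field_simp
  linear_combination hz.trans hs.symm

/-- **A `σ`-fixed NON-NORM UNIT**: from a `σ`-fixed non-norm `ε ≠ 0` (★ `IsCMField.exists_fixed_nonnorm_dichotomy'`) of even valuation `2n` (★ datum: fixed
elements have even valuation), `η = ε·N(ϖ)^n` is a fixed non-norm UNIT. [cite: Serre1979, Ch. V §3] -/
theorem exists_fixed_nonnorm_unit (hσ : ∀ z : K, σ (σ z) = z) (hvσ : ∀ a, Valued.v (σ a) = Valued.v a) {ϖ : K} (hϖ : Valued.v ϖ = exp (-1 : ℤ))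
    (heven : ∀ x : K, σ x = x → x ≠ 0 → ∃ n : ℤ, Valued.v x = exp (2 * n))
    {ε : K} (hσε : σ ε = ε) (hε0 : ε ≠ 0) (hεN : ¬ ∃ r : K, r * σ r = ε) :
    ∃ η : K, σ η = η ∧ Valued.v η = 1 ∧ ¬ ∃ r : K, r * σ r = η := by
  obtain ⟨n, hn⟩ := heven ε hσε hε0
  have hϖ0 : ϖ ≠ 0 := fun h => by rw [h, map_zero] at hϖ; exact WithZero.coe_ne_zero hϖ.symm
  have hσϖ0 : σ ϖ ≠ 0 := (map_ne_zero σ).2 hϖ0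
  have hN0 : ϖ * σ ϖ ≠ 0 := mul_ne_zero hϖ0 hσϖ0
  refine ⟨ε * (ϖ * σ ϖ) ^ n, ?_, ?_, ?_⟩
  · rw [map_mul, map_zpow₀, map_mul, hσ, hσε, mul_comm (σ ϖ) ϖ]
  · rw [map_mul, map_zpow₀, map_mul, hvσ, hϖ, hn, ← exp_add, ← exp_zsmul, ← exp_add, ← exp_zero]
    congr 1; simp only [smul_eq_mul]; ring
  · rintro ⟨r, hr⟩
    refine hεN ⟨r * (ϖ ^ n)⁻¹, ?_⟩
    rw [map_mul, map_inv₀, map_zpow₀]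
    have hz : (ϖ : K) ^ n ≠ 0 := zpow_ne_zero n hϖ0
    have hσz : (σ ϖ) ^ n ≠ 0 := zpow_ne_zero n hσϖ0
    rw [mul_zpow] at hr
    field_simp
    linear_combination hr

end Field

/-! ## §2 The class-`−` transvection diagonal witness at a ramified `σ`-stable place -/

section CM

variable (L : Type) [Field L] [NumberField L] [IsCMField L] {v : HeightOneSpectrum (𝓞 ↥(maximalRealSubfield L))}
  (w : UnitaryGroup.PlacesOver L v) (hw : IsCMField.complexConj L • w.1 = w.1)

/-- **THE CLASS-`−` DIAGONAL WITNESS** (REF5 R5-11 (T3), `T₋` entry): every class of `G` represented by a transvection WITHOUT `NormClassPlus` meets the support set of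
`f_{T−}` — some `x ∈ K` on the depth-`ℓ₀` shell with `¬ LabelPlus` at level `m*` has `ConjClasses.mk x = c` (witness `ψ⁻¹(n(η·t₊))`, `η` a fixed non-norm unit).
[cite: Rogawski1990, §3.9 p. 32; §4.9 Prop. 4.9.1 (b) p. 55] [cite: Serre1979, Ch. V §3] -/
theorem exists_mem_supportTransvMinus_mk_eq (he : v.asIdeal.ramificationIdx' w.1.asIdeal ≠ 1) (ϖ : w.1.adicCompletion L) (hϖ : Valued.v ϖ = WithZero.exp (-1 : ℤ))
    (c : ConjClasses ((UnitaryGroup.cmDatum L 3 (Matrix.of fun i j : Fin 3 => if i.val + j.val + 1 = 3 then (1 : L) else 0)).Local v))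
    (h0 : wMatrix L w hw (Quotient.out c) - 1 ≠ 0) (hsq : (wMatrix L w hw (Quotient.out c) - 1) * (wMatrix L w hw (Quotient.out c) - 1) = 0)
    (hN : ¬ NormClassPlus (galAdicCompletionMap (L := L) (IsCMField.complexConj L) hw) ϖ (dOfPlace L v w) (wMatrix L w hw (Quotient.out c) - 1)) :
    ∃ x : ((UnitaryGroup.cmDatum L 3 (Matrix.of fun i j : Fin 3 => if i.val + j.val + 1 = 3 then (1 : L) else 0)).Local v),
      x ∈ {u : ((UnitaryGroup.cmDatum L 3 (Matrix.of fun i j : Fin 3 => if i.val + j.val + 1 = 3 then (1 : L) else 0)).Local v) |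
        u ∈ cmLocalIntegralLevel L 3 (Matrix.of fun i j : Fin 3 => if i.val + j.val + 1 = 3 then (1 : L) else 0) v ∧
        NearTransvShell ϖ (dOfPlace L v w % 2) (mstarFn L v w) (wMatrix L w hw u - 1) ∧
        ¬ LabelPlus (galAdicCompletionMap (L := L) (IsCMField.complexConj L) hw) ϖ (dOfPlace L v w) (mstarFn L v w) (wMatrix L w hw u - 1)} ∧
      ConjClasses.mk x = c := by
  obtain ⟨hσσ, -⟩ := galAdicCompletionMap_involutive_and_two_ne_zero L w hw
  have hvσ : ∀ a : w.1.adicCompletion L, Valued.v (galAdicCompletionMap (L := L) (IsCMField.complexConj L) hw a) = Valued.v a :=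
    fun a => valued_galAdicCompletionMap (L := L) (IsCMField.complexConj L) hw a
  haveI := Literature.NumberTheory.LocalFields.isAdicComplete_valuedInteger_of_completeSpace hϖ
  -- the datum at `w`; rewrite `dOfPlace = d`, `mstarFn = m*(d)` everywhere
  obtain ⟨d, t, hD⟩ := exists_isRamifiedQuadraticDatum_of_placesOver L w hw he ϖ hϖ
  have hDd : dOfPlace L v w = d := dOfPlace_eq_of_isRamifiedQuadraticDatum L w hw he hD
  have hm : mstarFn L v w = mstarOfRecord d := by rw [mstarFn, hDd]
  rw [hDd] at hN
  simp only [Set.mem_setOf_eq, hm, hDd]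
  obtain ⟨hσ', hvσ', hϖ', heven, hd, h1d, h2t⟩ := hD
  have hk : 2 * ((d - d % 2) / 2) + d % 2 = d := by omega
  have hϖ0 : ϖ ≠ 0 := fun h => by rw [h, map_zero] at hϖ; exact WithZero.coe_ne_zero hϖ.symm
  -- the coefficient `t₊` and the fixed non-norm unit `η`
  obtain ⟨tp, htp⟩ : ∃ tp : w.1.adicCompletion L, (ϖ - galAdicCompletionMap (L := L) (IsCMField.complexConj L) hw ϖ) *
      ((ϖ * galAdicCompletionMap (L := L) (IsCMField.complexConj L) hw ϖ) ^ ((d - d % 2) / 2))⁻¹ = tp := ⟨_, rfl⟩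
  have hvtp : Valued.v tp = exp (-((d % 2 : ℕ) : ℤ)) := by
    rw [← htp, map_mul, map_inv₀, map_pow, map_mul, hvσ, hd, hϖ, ← pow_two, ← pow_mul, ← exp_nsmul, ← exp_nsmul, smul_neg, smul_neg, nsmul_eq_mul,
      nsmul_eq_mul, mul_one, mul_one, ← exp_neg, neg_neg, ← exp_add]
    congr 1; push_cast; omega
  have htp0 : tp ≠ 0 := fun h => by rw [h, map_zero] at hvtp; exact WithZero.coe_ne_zero hvtp.symm
  have hσtp : galAdicCompletionMap (L := L) (IsCMField.complexConj L) hw tp = -tp := by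
    rw [← htp, map_mul, map_inv₀, map_pow, map_mul, map_sub, hσσ, mul_comm (galAdicCompletionMap (L := L) (IsCMField.complexConj L) hw ϖ) ϖ]
    ring
  obtain ⟨ε, hσε, hε0, hεN, -⟩ := Literature.NumberTheory.LocalFields.IsCMField.exists_fixed_nonnorm_dichotomy' L w hw
  obtain ⟨η, hση, hvη, hηN⟩ := exists_fixed_nonnorm_unit (galAdicCompletionMap (L := L) (IsCMField.complexConj L) hw) hσσ hvσ hϖ heven hσε hε0 hεN
  have hvc : Valued.v (η * tp) = exp (-((d % 2 : ℕ) : ℤ)) := by rw [map_mul, hvη, one_mul, hvtp]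
  have hc0 : η * tp ≠ 0 := fun h => by rw [h, map_zero] at hvc; exact WithZero.coe_ne_zero hvc.symm
  -- the witness matrix `n(η t₊)`
  obtain ⟨g, hg, hg'⟩ := exists_units_coe_eq_cornerUnipotent (η * tp)
  have hgU : g ∈ unitaryGroupOfForm (galAdicCompletionMap (L := L) (IsCMField.complexConj L) hw) ((StdForm.antidiagonal 3).over (w.1.adicCompletion L)) := by
    rw [mem_unitaryGroupOfForm_iff_of_coe_eq_cornerUnipotent (galAdicCompletionMap (L := L) (IsCMField.complexConj L) hw) hg, map_mul, hση, hσtp]; ring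
  have hv0 : Valued.v (0 : w.1.adicCompletion L) ≤ 1 := by rw [map_zero]; exact zero_le
  have hv1 : Valued.v (1 : w.1.adicCompletion L) ≤ 1 := (map_one _).le
  have hvc1 : Valued.v (η * tp) ≤ 1 := by rw [hvc, ← exp_zero, exp_le_exp]; omega
  have hvc1' : Valued.v (-(η * tp)) ≤ 1 := by rw [Valuation.map_neg]; exact hvc1
  have hint : IsIntMatrix (g : Matrix (Fin 3) (Fin 3) (w.1.adicCompletion L)) := by
    intro i j
    rw [hg]
    fin_cases i <;> fin_cases j <;>
      simp only [Fin.zero_eta, Fin.mk_one, Fin.reduceFinMk, Fin.isValue, Matrix.of_apply, Matrix.cons_val', Matrix.cons_val_zero, Matrix.cons_val_one,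
        Matrix.cons_val_two, Matrix.empty_val', Matrix.cons_val_fin_one, Matrix.head_cons, Matrix.tail_cons, Matrix.head_fin_const] <;>
      first | exact hvc1 | exact hv0 | exact hv1
  have hint' : IsIntMatrix ((g⁻¹ : GL (Fin 3) (w.1.adicCompletion L)) : Matrix (Fin 3) (Fin 3) (w.1.adicCompletion L)) := by
    intro i j
    rw [hg']
    fin_cases i <;> fin_cases j <;>
      simp only [Fin.zero_eta, Fin.mk_one, Fin.reduceFinMk, Fin.isValue, Matrix.of_apply, Matrix.cons_val', Matrix.cons_val_zero, Matrix.cons_val_one,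
        Matrix.cons_val_two, Matrix.empty_val', Matrix.cons_val_fin_one, Matrix.head_cons, Matrix.tail_cons, Matrix.head_fin_const] <;>
      first | exact hvc1' | exact hv0 | exact hv1
  -- pull `g` back into `G`
  obtain ⟨x, hx⟩ := exists_conj_localNonsplitEquiv_eq L (Matrix.of fun i j : Fin 3 => if i.val + j.val + 1 = 3 then (1 : L) else 0) v w hw (T := 1)
    (placeForm_antidiagOne_eq_formCongr_one L w hw) hgU
  rw [one_mul, inv_one, mul_one] at hx
  have hX : wMatrix L w hw x - 1 = !![0, 0, η * tp; 0, 0, 0; 0, 0, 0] := by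
    show (((localNonsplitEquiv (IsCMField.complexConj L) (Matrix.of fun i j : Fin 3 => if i.val + j.val + 1 = 3 then (1 : L) else 0) (IsCMField.complexConj_ne_one L) w hw x :
        ↥(unitaryGroupOfForm (galAdicCompletionMap (L := L) (IsCMField.complexConj L) hw) (placeForm (Matrix.of fun i j : Fin 3 => if i.val + j.val + 1 = 3 then (1 : L) else 0) w.1))) :
          GL (Fin 3) (w.1.adicCompletion L)) : Matrix (Fin 3) (Fin 3) (w.1.adicCompletion L)) - 1 = _
    rw [hx, hg, cornerUnipotent_sub_one]
  refine ⟨x, ⟨?_, ⟨?_, ?_, ?_⟩, ?_⟩, ?_⟩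
  · -- `x ∈ K`
    refine (mem_cmLocalIntegralLevel_iff_isIntMatrix L 3 (Matrix.of fun i j : Fin 3 => if i.val + j.val + 1 = 3 then (1 : L) else 0)
      (IsCMField.complexConj_ne_one L) w hw x).2 ⟨?_, ?_⟩
    · rw [hx]; exact hint
    · rw [hx]; exact hint'
  · -- on the shell: depth `ℓ₀`
    rw [hX, inLevel_cornerNilp_iff, map_mul, map_inv₀, map_pow, hϖ, hvc, ← exp_nsmul, smul_neg, nsmul_eq_mul, mul_one, ← exp_neg, neg_neg, ← exp_add,
      ← exp_zero, exp_le_exp]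
    omega
  · -- not deeper
    rw [hX, inLevel_cornerNilp_iff, map_mul, map_inv₀, map_pow, hϖ, hvc, ← exp_nsmul, smul_neg, nsmul_eq_mul, mul_one, ← exp_neg, neg_neg, ← exp_add,
      ← exp_zero, exp_le_exp]
    push_cast; omega
  · -- `X² = 0 ∈ ϖ^{m*} M₃(𝒪)`
    rw [hX, cornerNilp_mul_self]
    intro i j
    rw [Matrix.zero_apply, mul_zero, map_zero]; exact zero_le
  · -- the label is `−` (the M-step)
    rw [hX, ← htp]
    exact not_labelPlus_corner_of_nonnorm_unit (galAdicCompletionMap (L := L) (IsCMField.complexConj L) hw) ϖ d t ⟨hσ', hvσ', hϖ', heven, hd, h1d, h2t⟩ hση hηN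
  · -- `x ~ out c`: both off the class `+`
    have h0' : wMatrix L w hw x - 1 ≠ 0 := by
      rw [hX]; intro h
      have := congrFun (congrFun h 0) 2
      simp only [Fin.isValue, Matrix.of_apply, Matrix.cons_val', Matrix.cons_val_zero, Matrix.cons_val_two, Matrix.empty_val', Matrix.cons_val_fin_one,
        Matrix.head_cons, Matrix.tail_cons, Matrix.zero_apply] at this
      exact hc0 this
    have hsq' : (wMatrix L w hw x - 1) * (wMatrix L w hw x - 1) = 0 := by rw [hX, cornerNilp_mul_self]
    have hN' : ¬ NormClassPlus (galAdicCompletionMap (L := L) (IsCMField.complexConj L) hw) ϖ d (wMatrix L w hw x - 1) := by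
      have hrw : wMatrix L w hw x - 1 = (((1 : GL (Fin 3) (w.1.adicCompletion L)) * g * (1 : GL (Fin 3) (w.1.adicCompletion L))⁻¹ : GL (Fin 3) (w.1.adicCompletion L)) :
          Matrix (Fin 3) (Fin 3) (w.1.adicCompletion L)) - 1 := by
        rw [one_mul, inv_one, mul_one, hX, hg, cornerUnipotent_sub_one]
      rw [hrw, normClassPlus_conj_corner_iff (galAdicCompletionMap (L := L) (IsCMField.complexConj L) hw) ϖ d hc0 hg (one_mem _), htp]
      rintro ⟨m, -, hm⟩
      refine hηN ⟨m, ?_⟩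
      have : η * tp = (m * galAdicCompletionMap (L := L) (IsCMField.complexConj L) hw m) * tp := by rw [hm]; ring
      exact (mul_right_cancel₀ htp0 this).symm ▸ rfl
    have hconj : IsConj (Quotient.out c) x := by
      rw [← hDd] at hN hN'
      exact isConj_of_not_normClassPlus L w hw he ϖ hϖ (dOfPlace L v w) h0 hsq hN h0' hsq' hN'
    rw [← Quotient.out_eq c, ConjClasses.quotient_mk_eq_mk]
    exact (ConjClasses.mk_eq_mk_iff_isConj.2 hconj).symm

end CM

end Summit.HodgeConjecture.HodgeConjecture.Cruxes.H413.F0P3cDyRamTableDiagWitnessTransvMinus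

end
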